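import Summits.Parity.GeneralizedHardyLittlewood.Theorems.BeyondDiagonalBeatsQuarter.KernelFormXSqEuler
import Summits.Parity.GeneralizedHardyLittlewood.Theorems.BeyondDiagonalBeatsQuarter.KernelFormXSqRiesz
import HarnessLib

/-!
# The `X²` Selberg coordinates: `S(y;n) = Σ_{k≤y,(k,n)=1} τ(k)W(k)log²(y/k) = 2E_n + O(D(n)/log²y)`

Supports stmt-Parity-20343 (`PrimeLevelFamEdge.BeyondDiagonalBeatsQuarter`, K_B; line
`diagonal_kernel_split`, registered stub `stub_kernelFormXSq`). A helper; it closes nothing. Namespace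
`Summit.Parity.GeneralizedHardyLittlewood.Theorems.BeyondDiagonalBeatsQuarter.KernelFormXSq`.

The analytic core of the q-free kernel asymptotics. The Selberg coordinates of the KMV mollifier at
the profile `X²` are `A_n = W(n)·S(M/n;n)/log²M` with
`S(y;n) = Σ_{k ≤ y, (k,n)=1} τ(k)W(k)·log²(y/k)` (`coprimeSum n y`; `W = μ/(id·ψ)`). Writing the
summand as `((μ/id)∗(μ/id)) ∗ h_n` (`KernelFormXSqLocal`) and rearranging,
`S(y;n) = Σ_{m ≤ y} h_n(m)·R⁽²⁾(y/m)` with `R⁽²⁾` the second logarithmic Riesz mean of `(μ∗μ)/id`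
(`= 2 + O(log⁻²)`, `KernelFormXSqRiesz`); since `Σ_m |h_n(m)|m^{1/8} ≪ D(n) = Σ_{d∣n} d^{−3/4}`
(`KernelFormXSqLocalSum`) and `Σ_m h_n(m) = E_n = ζ(2)∏_{p∣n}(p+1)/(p−1)` (`KernelFormXSqEuler`):

* `abs_coprimeSum_sub_le` — **`|S(y;n) − 2E_n| ≤ C·D(n)/(1 + log y)²`** for all `y ≥ 1`, `n ≥ 1`,
  with an absolute `C`;
* `mainConst_le_divWeight`, `abs_coprimeSum_le` — the crude bounds `E_n ≤ C·D(n)`,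
  `|S(y;n)| ≤ C·D(n)`.

The three definitions (`coprimeSum`, `mainConst`, `divWeight`) are bookkeeping abbreviations with
bodies. Everything here is PROVED.

## References
* E. Kowalski, P. Michel, J. VanderKam, J. reine angew. Math. 526 (2000), Prop. 5.1 p. 18 (the
  residue evaluation behind (31), here for `P = X²` in real variables and uniformly in `n`).
  [cite: KowalskiMichelVanderKam2000, Prop. 5.1 — derivation]
«The programme SEARCHES and TYPES; no claim about Landau–Siegel zeros, Theorems 1–2 of
arXiv:2211.02515 or a repaired Margin232 until a kernel theorem says so.»
-/

noncomputable section

open scoped Real ArithmeticFunction.Moebius ArithmeticFunction.sigma ArithmeticFunction.zeta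
open Finset ArithmeticFunction

namespace Summit.Parity.GeneralizedHardyLittlewood.Theorems.BeyondDiagonalBeatsQuarter.KernelFormXSq

open Literature.NumberTheory.LFunctions Literature.NumberTheory.LFunctions.KMV2000
open MollifierMainTerm (W G invA moebiusRiesz)
open Literature.Barriers.Parity (Icc_one_eq_Ioc_zero)

/-! ### Definitions -/

/-- `S(y;n) = Σ_{k ≤ y, (k,n)=1} τ(k)W(k)·log²(y/k)`: the `X²`-profile Selberg coordinate sum
(`A_n = W(n)·S(M/n;n)/log²M`). [cite: KowalskiMichelVanderKam2000, §5 (23) — derivation (bookkeeping abbreviation)] -/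
def coprimeSum (n : ℕ) (y : ℝ) : ℝ := ∑ k ∈ Icc 1 ⌊y⌋₊, copTauW n k * Real.log (y / k) ^ 2

/-- `E_n = ζ(2)·∏_{p∣n}(p+1)/(p−1) = Σ_m h_n(m)`, half the limit of `S(y;n)`.
[cite: KowalskiMichelVanderKam2000, Prop. 5.1 — derivation (bookkeeping abbreviation)] -/
def mainConst (n : ℕ) : ℝ := π ^ 2 / 6 * ∏ p ∈ n.primeFactors, (((p : ℝ) + 1) / ((p : ℝ) - 1))

/-- `D(n) = Σ_{d∣n} d^{−3/4}`, the arithmetic weight of the error terms. [folklore] -/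
def divWeight (n : ℕ) : ℝ := ∑ d ∈ n.divisors, (d : ℝ) ^ (-(3 / 4 : ℝ))

/-- `D(n) ≥ 1` for `n ≥ 1` (the divisor `d = 1`). [folklore] -/
theorem one_le_divWeight {n : ℕ} (hn : n ≠ 0) : 1 ≤ divWeight n := by
  unfold divWeight
  have h1 : (1 : ℕ) ∈ n.divisors := Nat.one_mem_divisors.2 hn
  have := Finset.single_le_sum (f := fun d : ℕ ↦ (d : ℝ) ^ (-(3 / 4 : ℝ)))
    (fun d _ ↦ by positivity) h1
  simpa using this

/-- `D(n) ≥ 0`. [folklore] -/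
theorem divWeight_nonneg (n : ℕ) : 0 ≤ divWeight n :=
  Finset.sum_nonneg fun d _ ↦ by positivity

/-! ### The rearrangement `S(y;n) = Σ_{m ≤ y} h_n(m)·R⁽²⁾(y/m)` -/

/-- `Σ_{j ≤ z} (G∗G)(j) log²(z/j) = R⁽²⁾(z) = Σ_{d ≤ z} μ(d)/d·R₂(z/d)`. [folklore] -/
theorem sum_G_mul_G_eq_moebiusSqRiesz (z : ℝ) :
    ∑ j ∈ Icc 1 ⌊z⌋₊, (G * G) j * Real.log (z / j) ^ 2 =
      ∑ d ∈ Icc 1 ⌊z⌋₊, (μ d : ℝ) / d * moebiusRiesz 2 (z / d) := by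
  rw [moebiusSqRiesz_eq_sum z, Icc_one_eq_Ioc_zero]
  have h1 : ∑ j ∈ Ioc 0 ⌊z⌋₊, (G * G) j * Real.log (z / j) ^ 2 =
      ∑ j ∈ Ioc 0 ⌊z⌋₊, ∑ x ∈ j.divisorsAntidiagonal,
        G x.1 * G x.2 * Real.log (z / ((x.1 * x.2 : ℕ) : ℝ)) ^ 2 := by
    refine Finset.sum_congr rfl fun j _ ↦ ?_
    rw [mul_apply, Finset.sum_mul]
    refine Finset.sum_congr rfl fun x hx ↦ ?_
    rw [(Nat.mem_divisorsAntidiagonal.1 hx).1]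
  rw [h1, SiegelWalfiszLiouville.sum_Ioc_sum_divisorsAntidiagonal_eq
    (fun a b ↦ G a * G b * Real.log (z / ((a * b : ℕ) : ℝ)) ^ 2) ⌊z⌋₊]
  refine Finset.sum_congr rfl fun d _ ↦ Finset.sum_congr rfl fun e _ ↦ ?_
  rw [G_apply', G_apply']
  push_cast
  ring

/-- **`S(y;n) = Σ_{m ≤ y} h_n(m)·R⁽²⁾(y/m)`** (Dirichlet's rearrangement of `f_n = h_n ∗ (G∗G)`).
[cite: KowalskiMichelVanderKam2000, Prop. 5.1 — derivation] -/
theorem coprimeSum_eq_sum_hloc (n : ℕ) (y : ℝ) :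
    coprimeSum n y = ∑ m ∈ Icc 1 ⌊y⌋₊, hloc n m *
      ∑ d ∈ Icc 1 ⌊y / m⌋₊, (μ d : ℝ) / d * moebiusRiesz 2 (y / m / d) := by
  unfold coprimeSum
  rw [copTauW_eq_G_mul_G_mul_hloc, mul_comm (G * G) (hloc n), Icc_one_eq_Ioc_zero]
  have h1 : ∑ k ∈ Ioc 0 ⌊y⌋₊, (hloc n * (G * G)) k * Real.log (y / k) ^ 2 =
      ∑ k ∈ Ioc 0 ⌊y⌋₊, ∑ x ∈ k.divisorsAntidiagonal,
        hloc n x.1 * (G * G) x.2 * Real.log (y / ((x.1 * x.2 : ℕ) : ℝ)) ^ 2 := by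
    refine Finset.sum_congr rfl fun k _ ↦ ?_
    rw [mul_apply, Finset.sum_mul]
    refine Finset.sum_congr rfl fun x hx ↦ ?_
    rw [(Nat.mem_divisorsAntidiagonal.1 hx).1]
  rw [h1, SiegelWalfiszLiouville.sum_Ioc_sum_divisorsAntidiagonal_eq
    (fun a b ↦ hloc n a * (G * G) b * Real.log (y / ((a * b : ℕ) : ℝ)) ^ 2) ⌊y⌋₊]
  refine Finset.sum_congr rfl fun m hm ↦ ?_
  have hm0 : (0 : ℝ) < m := by exact_mod_cast (Finset.mem_Ioc.1 hm).1
  rw [← sum_G_mul_G_eq_moebiusSqRiesz, Nat.floor_div_natCast, Icc_one_eq_Ioc_zero, Finset.mul_sum]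
  refine Finset.sum_congr rfl fun j _ ↦ ?_
  push_cast
  rw [div_div]
  ring


/-! ### Elementary weights -/

/-- For `1 ≤ m ≤ y`: `1/(1 + log(y/m))² ≤ m^{1/8}·(4/(1 + log y)² + y^{−1/16})` (split at `m = √y`).
[folklore] -/
theorem inv_log_sq_le_rpow_mul {y : ℝ} (hy : 1 ≤ y) {m : ℕ} (hm1 : 1 ≤ m) (hmy : (m : ℝ) ≤ y) :
    1 / (1 + Real.log (y / m)) ^ 2 ≤
      (m : ℝ) ^ (1 / 8 : ℝ) * (4 / (1 + Real.log y) ^ 2 + y ^ (-(1 / 16 : ℝ))) := by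
  have hy0 : 0 < y := by linarith
  have hm0 : (0 : ℝ) < m := by exact_mod_cast hm1
  have hm1' : (1 : ℝ) ≤ m := by exact_mod_cast hm1
  have hL : 0 ≤ Real.log y := Real.log_nonneg hy
  have hym : 1 ≤ y / m := by rw [le_div_iff₀ hm0]; linarith
  have hlog : 0 ≤ Real.log (y / m) := Real.log_nonneg hym
  have hm8 : 1 ≤ (m : ℝ) ^ (1 / 8 : ℝ) := Real.one_le_rpow hm1' (by norm_num)
  have hA : 0 ≤ 4 / (1 + Real.log y) ^ 2 := by positivity
  have hB : 0 ≤ y ^ (-(1 / 16 : ℝ)) := by positivity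
  rcases le_or_gt (m : ℝ) (Real.sqrt y) with hms | hms
  · -- `m ≤ √y`: `log(y/m) ≥ (log y)/2`
    have hlow : Real.log y / 2 ≤ Real.log (y / m) := by
      rw [Real.log_div hy0.ne' hm0.ne']
      have h1 : Real.log m ≤ Real.log (Real.sqrt y) := Real.log_le_log hm0 hms
      rw [Real.log_sqrt hy0.le] at h1
      linarith
    have h1 : 1 / (1 + Real.log (y / m)) ^ 2 ≤ 4 / (1 + Real.log y) ^ 2 := by
      rw [div_le_div_iff₀ (by positivity) (by positivity), one_mul]
      have : (1 + Real.log y) ^ 2 ≤ (2 * (1 + Real.log (y / m))) ^ 2 :=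
        pow_le_pow_left₀ (by positivity) (by linarith) 2
      linarith
    calc 1 / (1 + Real.log (y / m)) ^ 2 ≤ 4 / (1 + Real.log y) ^ 2 := h1
      _ ≤ (m : ℝ) ^ (1 / 8 : ℝ) * (4 / (1 + Real.log y) ^ 2) := le_mul_of_one_le_left hA hm8
      _ ≤ (m : ℝ) ^ (1 / 8 : ℝ) * (4 / (1 + Real.log y) ^ 2 + y ^ (-(1 / 16 : ℝ))) := by
          gcongr; linarith
  · -- `m > √y`: the weight is `≤ 1 ≤ m^{1/8} y^{-1/16}`
    have h1 : 1 / (1 + Real.log (y / m)) ^ 2 ≤ 1 := by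
      rw [div_le_one (by positivity)]
      nlinarith
    have h2 : 1 ≤ (m : ℝ) ^ (1 / 8 : ℝ) * y ^ (-(1 / 16 : ℝ)) := by
      have hs : Real.sqrt y ^ (1 / 8 : ℝ) ≤ (m : ℝ) ^ (1 / 8 : ℝ) :=
        Real.rpow_le_rpow (Real.sqrt_nonneg y) hms.le (by norm_num)
      have hs' : Real.sqrt y ^ (1 / 8 : ℝ) = y ^ (1 / 16 : ℝ) := by
        rw [Real.sqrt_eq_rpow, ← Real.rpow_mul hy0.le]; norm_num
      rw [hs'] at hs
      have hy16 : 0 < y ^ (1 / 16 : ℝ) := by positivity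
      rw [Real.rpow_neg hy0.le, ← div_eq_mul_inv, le_div_iff₀ hy16, one_mul]
      exact hs
    calc 1 / (1 + Real.log (y / m)) ^ 2 ≤ 1 := h1
      _ ≤ (m : ℝ) ^ (1 / 8 : ℝ) * y ^ (-(1 / 16 : ℝ)) := h2
      _ ≤ (m : ℝ) ^ (1 / 8 : ℝ) * (4 / (1 + Real.log y) ^ 2 + y ^ (-(1 / 16 : ℝ))) := by
          gcongr; linarith

/-- `y^{−1/16} ≤ 33²/(1 + log y)²` for `y ≥ 1` (`log y ≤ 32 y^{1/32}`). [folklore] -/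
theorem rpow_neg_sixteenth_le {y : ℝ} (hy : 1 ≤ y) :
    y ^ (-(1 / 16 : ℝ)) ≤ 33 ^ 2 / (1 + Real.log y) ^ 2 := by
  have hy0 : 0 < y := by linarith
  have hL : 0 ≤ Real.log y := Real.log_nonneg hy
  have h1 : Real.log y ≤ y ^ (1 / 32 : ℝ) / (1 / 32) := Real.log_le_rpow_div hy0.le (by norm_num)
  have h32 : 1 ≤ y ^ (1 / 32 : ℝ) := Real.one_le_rpow hy (by norm_num)
  have h2 : 1 + Real.log y ≤ 33 * y ^ (1 / 32 : ℝ) := by linarith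
  have h3 : (1 + Real.log y) ^ 2 ≤ 33 ^ 2 * y ^ (1 / 16 : ℝ) := by
    calc (1 + Real.log y) ^ 2 ≤ (33 * y ^ (1 / 32 : ℝ)) ^ 2 := pow_le_pow_left₀ (by positivity) h2 2
      _ = 33 ^ 2 * y ^ (1 / 16 : ℝ) := by
          rw [mul_pow, ← Real.rpow_natCast (y ^ (1 / 32 : ℝ)) 2, ← Real.rpow_mul hy0.le]; norm_num
  have hy16 : 0 < y ^ (1 / 16 : ℝ) := by positivity
  rw [Real.rpow_neg hy0.le, inv_eq_one_div, div_le_div_iff₀ hy16 (by positivity), one_mul]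
  linarith

/-! ### The core bound -/

/-- The core bound with the inner Riesz means abstracted: if `|F(m) − 2| ≤ C_A/(1 + log(y/m))²` for
`m ≤ y`, then `|Σ_{m ≤ y} h_n(m)F(m) − 2E_n| ≤ (C_A C_h(4 + 33²) + 2C_h 33²)·D(n)/(1 + log y)²`, where
`C_h` is the constant of `tsum_abs_hloc_mul_rpow_le`. [cite: KowalskiMichelVanderKam2000, Prop. 5.1 — derivation] -/
theorem abs_sum_hloc_mul_sub_le {C_A C_h : ℝ} (hC_A : 0 ≤ C_A)
    (hH : ∀ n : ℕ, n ≠ 0 → ∑' m : ℕ, |hloc n m| * (m : ℝ) ^ (1 / 8 : ℝ) ≤ C_h * divWeight n)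
    {n : ℕ} (hn : n ≠ 0) {y : ℝ} (hy : 1 ≤ y) {F : ℕ → ℝ}
    (hF : ∀ m ∈ Icc 1 ⌊y⌋₊, |F m - 2| ≤ C_A / (1 + Real.log (y / m)) ^ 2) :
    |∑ m ∈ Icc 1 ⌊y⌋₊, hloc n m * F m - 2 * mainConst n| ≤
      (C_A * C_h * (4 + 33 ^ 2) + 2 * C_h * 33 ^ 2) * divWeight n / (1 + Real.log y) ^ 2 := by
  have hy0 : 0 < y := by linarith
  set N : ℕ := ⌊y⌋₊ with hN
  set L : ℝ := Real.log y with hLdef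
  have hL : 0 ≤ L := Real.log_nonneg hy
  have hNy : (N : ℝ) ≤ y := Nat.floor_le hy0.le
  have hyN : y < N + 1 := Nat.lt_floor_add_one y
  set D : ℝ := divWeight n with hDdef
  have hD0 : 0 ≤ D := divWeight_nonneg n
  have hHn : ∑' m : ℕ, |hloc n m| * (m : ℝ) ^ (1 / 8 : ℝ) ≤ C_h * D := hH n hn
  have hCh0 : 0 ≤ C_h * D := le_trans (tsum_nonneg fun m ↦ by positivity) hHn
  have hsw := summable_abs_hloc_mul_rpow hn
  have hsh := summable_hloc hn
  -- the tail of `Σ h_n = E_n`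
  have hE : mainConst n = ∑ m ∈ Icc 1 N, hloc n m + ∑' i, hloc n (i + (N + 1)) := by
    rw [mainConst, ← (hasSum_hloc hn).tsum_eq,
      ← Summable.sum_add_tsum_nat_add (f := fun m ↦ hloc n m) (N + 1) hsh]
    congr 1
    have hr : Finset.range (N + 1) = insert 0 (Icc 1 N) := by
      ext m; simp only [Finset.mem_range, Finset.mem_insert, Finset.mem_Icc]; omega
    rw [hr, Finset.sum_insert (by simp), ArithmeticFunction.map_zero, zero_add]
  have hsplit : ∑ m ∈ Icc 1 N, hloc n m * (F m - 2) =
      ∑ m ∈ Icc 1 N, hloc n m * F m - 2 * ∑ m ∈ Icc 1 N, hloc n m := by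
    rw [Finset.mul_sum, ← Finset.sum_sub_distrib]
    exact Finset.sum_congr rfl fun m _ ↦ by ring
  have hdec : ∑ m ∈ Icc 1 N, hloc n m * F m - 2 * mainConst n =
      ∑ m ∈ Icc 1 N, hloc n m * (F m - 2) - 2 * ∑' i, hloc n (i + (N + 1)) := by
    rw [hE, hsplit]; ring
  rw [hdec]
  -- the weighted sum
  set B : ℝ := 4 / (1 + L) ^ 2 + y ^ (-(1 / 16 : ℝ)) with hBdef
  have hB0 : 0 ≤ B := by positivity
  have hterm : ∀ m ∈ Icc 1 N, |hloc n m * (F m - 2)| ≤ C_A * B * (|hloc n m| * (m : ℝ) ^ (1 / 8 : ℝ)) := by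
    intro m hm
    have hm' := Finset.mem_Icc.1 hm
    have hm0 : (0 : ℝ) < m := by exact_mod_cast hm'.1
    have hmy : (m : ℝ) ≤ y := le_trans (by exact_mod_cast hm'.2) hNy
    have h1 : |F m - 2| ≤ C_A / (1 + Real.log (y / m)) ^ 2 := hF m hm
    have h2 := inv_log_sq_le_rpow_mul hy hm'.1 hmy
    rw [abs_mul]
    calc |hloc n m| * |F m - 2| ≤ |hloc n m| * (C_A / (1 + Real.log (y / m)) ^ 2) :=
          mul_le_mul_of_nonneg_left h1 (abs_nonneg _)
      _ = |hloc n m| * C_A * (1 / (1 + Real.log (y / m)) ^ 2) := by ring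
      _ ≤ |hloc n m| * C_A * ((m : ℝ) ^ (1 / 8 : ℝ) * B) :=
          mul_le_mul_of_nonneg_left h2 (by positivity)
      _ = C_A * B * (|hloc n m| * (m : ℝ) ^ (1 / 8 : ℝ)) := by ring
  have hfin : ∑ m ∈ Icc 1 N, |hloc n m| * (m : ℝ) ^ (1 / 8 : ℝ) ≤ C_h * D :=
    (hsw.sum_le_tsum (Icc 1 N) fun m _ ↦ by positivity).trans hHn
  have hW : |∑ m ∈ Icc 1 N, hloc n m * (F m - 2)| ≤ C_A * B * (C_h * D) := by
    refine (Finset.abs_sum_le_sum_abs _ _).trans ((Finset.sum_le_sum hterm).trans ?_)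
    rw [← Finset.mul_sum]
    exact mul_le_mul_of_nonneg_left hfin (by positivity)
  -- the tail
  have hT : |∑' i, hloc n (i + (N + 1))| ≤ y ^ (-(1 / 8 : ℝ)) * (C_h * D) := by
    set f : ℕ → ℝ := fun m ↦ hloc n m with hf
    set w : ℕ → ℝ := fun m ↦ |hloc n m| * (m : ℝ) ^ (1 / 8 : ℝ) with hw
    have hsh' : Summable f := hsh
    have hsw' : Summable w := hsw
    have hst : Summable fun i ↦ f (i + (N + 1)) := (summable_nat_add_iff (N + 1)).2 hsh'
    have hswt : Summable fun i ↦ w (i + (N + 1)) := (summable_nat_add_iff (N + 1)).2 hsw'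
    have hy8 : 0 < y ^ (1 / 8 : ℝ) := by positivity
    have hpt : ∀ i, |f (i + (N + 1))| ≤ y ^ (-(1 / 8 : ℝ)) * w (i + (N + 1)) := by
      intro i
      simp only [hf, hw]
      have hiy : y ≤ ((i + (N + 1) : ℕ) : ℝ) := by push_cast; linarith
      have h8 : y ^ (1 / 8 : ℝ) ≤ ((i + (N + 1) : ℕ) : ℝ) ^ (1 / 8 : ℝ) :=
        Real.rpow_le_rpow hy0.le hiy (by norm_num)
      rw [Real.rpow_neg hy0.le, ← div_eq_inv_mul, le_div_iff₀ hy8]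
      exact mul_le_mul_of_nonneg_left h8 (abs_nonneg _)
    have htail : ∑' i, w (i + (N + 1)) ≤ C_h * D := by
      refine le_trans ?_ hHn
      have h := hsw'.sum_add_tsum_nat_add (N + 1)
      have hnn : 0 ≤ ∑ i ∈ Finset.range (N + 1), w i :=
        Finset.sum_nonneg fun i _ ↦ by simp only [hw]; positivity
      change ∑' i, w (i + (N + 1)) ≤ ∑' m, w m
      linarith
    have hup : ∑' i, f (i + (N + 1)) ≤ ∑' i, |f (i + (N + 1))| :=
      hst.tsum_le_tsum (fun i ↦ le_abs_self _) hst.abs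
    have hdown : -∑' i, |f (i + (N + 1))| ≤ ∑' i, f (i + (N + 1)) := by
      rw [← tsum_neg]
      exact hst.abs.neg.tsum_le_tsum (fun i ↦ neg_abs_le _) hst
    have habs : |∑' i, f (i + (N + 1))| ≤ ∑' i, |f (i + (N + 1))| := abs_le.2 ⟨hdown, hup⟩
    have hcmp : ∑' i, |f (i + (N + 1))| ≤ ∑' i, y ^ (-(1 / 8 : ℝ)) * w (i + (N + 1)) :=
      hst.abs.tsum_le_tsum hpt (hswt.mul_left _)
    change |∑' i, f (i + (N + 1))| ≤ _
    calc |∑' i, f (i + (N + 1))| ≤ ∑' i, |f (i + (N + 1))| := habs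
      _ ≤ ∑' i, y ^ (-(1 / 8 : ℝ)) * w (i + (N + 1)) := hcmp
      _ = y ^ (-(1 / 8 : ℝ)) * ∑' i, w (i + (N + 1)) := tsum_mul_left
      _ ≤ y ^ (-(1 / 8 : ℝ)) * (C_h * D) := mul_le_mul_of_nonneg_left htail (by positivity)
  -- collect
  have hy16 : y ^ (-(1 / 16 : ℝ)) ≤ 33 ^ 2 / (1 + L) ^ 2 := rpow_neg_sixteenth_le hy
  have hy8le : y ^ (-(1 / 8 : ℝ)) ≤ y ^ (-(1 / 16 : ℝ)) :=
    Real.rpow_le_rpow_of_exponent_le hy (by norm_num)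
  have hBle : B ≤ (4 + 33 ^ 2) / (1 + L) ^ 2 := by
    rw [hBdef, add_div]; linarith
  have h1 : C_A * B * (C_h * D) ≤ C_A * ((4 + 33 ^ 2) / (1 + L) ^ 2) * (C_h * D) :=
    mul_le_mul_of_nonneg_right (mul_le_mul_of_nonneg_left hBle hC_A) hCh0
  have h2 : 2 * (y ^ (-(1 / 8 : ℝ)) * (C_h * D)) ≤ 2 * ((33 ^ 2 / (1 + L) ^ 2) * (C_h * D)) :=
    mul_le_mul_of_nonneg_left (mul_le_mul_of_nonneg_right (hy8le.trans hy16) hCh0) zero_le_two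
  have hL1 : (1 + L) ^ 2 ≠ 0 := by positivity
  calc |∑ m ∈ Icc 1 N, hloc n m * (F m - 2) - 2 * ∑' i, hloc n (i + (N + 1))|
      ≤ |∑ m ∈ Icc 1 N, hloc n m * (F m - 2)| + |2 * ∑' i, hloc n (i + (N + 1))| := abs_sub _ _
    _ ≤ C_A * B * (C_h * D) + 2 * (y ^ (-(1 / 8 : ℝ)) * (C_h * D)) := by
        rw [abs_mul, abs_two]
        exact add_le_add hW (mul_le_mul_of_nonneg_left hT zero_le_two)
    _ ≤ C_A * ((4 + 33 ^ 2) / (1 + L) ^ 2) * (C_h * D) + 2 * ((33 ^ 2 / (1 + L) ^ 2) * (C_h * D)) :=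
        add_le_add h1 h2
    _ = (C_A * C_h * (4 + 33 ^ 2) + 2 * C_h * 33 ^ 2) * D / (1 + L) ^ 2 := by
        field_simp

/-- **`|S(y;n) − 2E_n| ≤ C·D(n)/(1 + log y)²** for all `y ≥ 1`, `n ≥ 1`, with an absolute `C`:
`S(y;n) − 2E_n = Σ_{m ≤ y} h_n(m)(R⁽²⁾(y/m) − 2) − 2Σ_{m > y} h_n(m)`, `|R⁽²⁾ − 2| ≪ log⁻²`,
`Σ|h_n(m)|m^{1/8} ≪ D(n)`. [cite: KowalskiMichelVanderKam2000, Prop. 5.1 — derivation (uniform in the coprimality modulus)] -/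
theorem abs_coprimeSum_sub_le :
    ∃ C : ℝ, 0 < C ∧ ∀ n : ℕ, n ≠ 0 → ∀ y : ℝ, 1 ≤ y →
      |coprimeSum n y - 2 * mainConst n| ≤ C * divWeight n / (1 + Real.log y) ^ 2 := by
  obtain ⟨C_A, hC_A, hA⟩ := abs_moebiusSqRiesz_sub_two_le
  obtain ⟨C_h, hC_h, hH⟩ := tsum_abs_hloc_mul_rpow_le
  refine ⟨C_A * C_h * (4 + 33 ^ 2) + 2 * C_h * 33 ^ 2, by positivity, fun n hn y hy ↦ ?_⟩
  have hy0 : 0 < y := by linarith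
  rw [coprimeSum_eq_sum_hloc]
  refine abs_sum_hloc_mul_sub_le hC_A.le (fun n hn ↦ hH n hn) hn hy fun m hm ↦ ?_
  have hm' := Finset.mem_Icc.1 hm
  have hm0 : (0 : ℝ) < m := by exact_mod_cast hm'.1
  have hmy : (m : ℝ) ≤ y := le_trans (by exact_mod_cast hm'.2) (Nat.floor_le hy0.le)
  have hym : 1 ≤ y / m := by rw [le_div_iff₀ hm0]; linarith
  exact hA (y / m) hym

/-- `E_n ≤ C_h·D(n)`: the main constant is dominated by the weighted `ℓ¹` norm of `h_n`
(`E_n = Σ h_n ≤ Σ|h_n| ≤ Σ|h_n|m^{1/8}`). [folklore] -/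
theorem mainConst_le_divWeight :
    ∃ C : ℝ, 0 < C ∧ ∀ n : ℕ, n ≠ 0 → mainConst n ≤ C * divWeight n := by
  obtain ⟨C_h, hC_h, hH⟩ := tsum_abs_hloc_mul_rpow_le
  refine ⟨C_h, hC_h, fun n hn ↦ ?_⟩
  rw [mainConst, ← (hasSum_hloc hn).tsum_eq]
  refine le_trans ?_ (hH n hn)
  refine (summable_hloc hn).tsum_le_tsum (fun m ↦ ?_) (summable_abs_hloc_mul_rpow hn)
  exact (le_abs_self _).trans (abs_hloc_le_mul_rpow n m)

/-- `0 ≤ E_n`. [folklore] -/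
theorem mainConst_nonneg (n : ℕ) : 0 ≤ mainConst n := by
  unfold mainConst
  refine mul_nonneg (by positivity) (Finset.prod_nonneg fun p hp ↦ ?_)
  have h2 : (2 : ℝ) ≤ p := by exact_mod_cast (Nat.prime_of_mem_primeFactors hp).two_le
  exact div_nonneg (by linarith) (by linarith)

/-- **`|S(y;n)| ≤ C·D(n)`** for `y ≥ 1`, `n ≥ 1` (crude form of the core bound). [folklore] -/
theorem abs_coprimeSum_le :
    ∃ C : ℝ, 0 < C ∧ ∀ n : ℕ, n ≠ 0 → ∀ y : ℝ, 1 ≤ y → |coprimeSum n y| ≤ C * divWeight n := by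
  obtain ⟨C₁, hC₁, h1⟩ := abs_coprimeSum_sub_le
  obtain ⟨C₂, hC₂, h2⟩ := mainConst_le_divWeight
  refine ⟨C₁ + 2 * C₂, by positivity, fun n hn y hy ↦ ?_⟩
  have hL : 0 ≤ Real.log y := Real.log_nonneg hy
  have hD := divWeight_nonneg n
  have ha := h1 n hn y hy
  have hb := h2 n hn
  have hE0 := mainConst_nonneg n
  have ha' : C₁ * divWeight n / (1 + Real.log y) ^ 2 ≤ C₁ * divWeight n :=
    div_le_self (by positivity) (one_le_pow₀ (by linarith))
  calc |coprimeSum n y| = |(coprimeSum n y - 2 * mainConst n) + 2 * mainConst n| := by ring_nf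
    _ ≤ |coprimeSum n y - 2 * mainConst n| + |2 * mainConst n| := abs_add_le _ _
    _ ≤ C₁ * divWeight n + 2 * (C₂ * divWeight n) := by
        rw [abs_of_nonneg (by linarith : (0 : ℝ) ≤ 2 * mainConst n)]
        exact add_le_add (ha.trans ha') (by linarith)
    _ = (C₁ + 2 * C₂) * divWeight n := by ring
end Summit.Parity.GeneralizedHardyLittlewood.Theorems.BeyondDiagonalBeatsQuarter.KernelFormXSq
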